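import Literature.NumberTheory.LFunctions.Zhang2022.RepairGapLemma101ShortPremise
import Literature.NumberTheory.LFunctions.Zhang2022.RepairGapLemma82Premise
import Literature.NumberTheory.LFunctions.Zhang2022.Section10Lemma101MainRanges
import HarnessLib

/-!
# Zhang (2022), rescue GAP/BED (D-0124 (3)(4)): Lemma 10.1, the uniform Riesz bound and the MAIN RANGES (10.3)/(10.4)
# under the minimum premise `‖L(1,χ)‖ ≤ 𝓛⁻¹⁵` (node group 2: §10 → (10.17); GAP G-31 «main terms only E ≥ 15»)

Topic `Literature/NumberTheory/LFunctions/Zhang2022` (Landau–Siegel audit tree; verdict-neutral).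
Y. Zhang, *Discrete mean estimates and the Landau–Siegel zero*, arXiv:2211.02515v1 (2022)
[Zhang2022LandauSiegel] — **an unrefereed manuscript under adjudication; nothing in this file asserts or
denies its Theorems 1–2, and nothing here is a claim about Landau–Siegel zeros. The programme SEARCHES and
TYPES; no claim about Landau–Siegel zeros, Theorems 1–2 of arXiv:2211.02515 or a repaired Margin232 until a
kernel theorem says so.**

Second of three files re-running Lemma 10.1 (tree `Section10Lemma101MainRanges`) VERBATIM under `‖L(1,χ)‖ ≤ 𝓛⁻¹⁵`:
`norm_riesz_le_pow15` (uniform `O_{c′}(𝓛²)` bound on `0 < X ≤ P`: short part = `norm_riesz_short_le_pow15`, long part = the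
Lemma 8.2 core twin `Repair.Gap.sum_twist_log_sub_main_le_pow15`), `range_two_pow15` ((10.3): main term
`(500L′(1,χ)/log P)(−1 − β_j log(y/P^{0.5}))`, error `≤ 1500·C82(3+5c′)𝓛⁻¹⁵`) and `range_three_pow15` ((10.4)). SAME constants
and thresholds as the tree; the (A)-free helpers `Lemma101.params` / `betaJ_re_norm` / `setting` / `C82_nonneg` are the
tree's, cited not restated. Theorems only; no definition, no named fact; nothing about (A) itself.

## References

* Y. Zhang, arXiv:2211.02515v1 (2022), §10 Lemma 10.1, (10.3), (10.4); §8 Lemma 8.2; §5 Lemma 5.8.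
  [cite: Zhang2022LandauSiegel, §10 Lemma 10.1]
-/

noncomputable section

open Complex Real

namespace Literature.NumberTheory.LFunctions.Zhang2022.Lemma101

open Literature.NumberTheory.LFunctions.Zhang2022.Skeleton
open Literature.NumberTheory.LFunctions.Zhang2022.Lemma82 (twist C82)

variable {D : ℕ} (χ : DirichletCharacter ℂ D)

/-- **Uniform Riesz bound under the minimum premise** (twin of `Lemma101.norm_riesz_le`): for `0 < X ≤ P`,
`‖Σ_{m≤X} χ(m)m^{−1−δ}log(X/m)‖ ≤ (5 + 4Kπ + 4e^{9/2}(1 + Kπ) + C82(K))𝓛²`, `‖L(1,χ)‖ ≤ 𝓛⁻¹⁵` in place of (A).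
[cite: Zhang2022LandauSiegel, §10 proof of Lemma 10.1] -/
theorem norm_riesz_le_pow15 [NeZero D] (hprim : χ.IsPrimitive) {K : ℝ} (hK0 : 0 ≤ K)
    (hL : 200 + K * π ≤ Real.log D) (h15 : ‖χ.LFunction 1‖ ≤ 1 / Real.log D ^ 15)
    {δ : ℂ} (hδre : δ.re = 0) (hδ : ‖δ‖ ≤ K * π / Real.log D ^ 9)
    {X : ℝ} (hX0 : 0 < X) (hXP : X ≤ Real.exp (Real.log D ^ 9)) :
    ‖∑ m ∈ Finset.Ioc 0 ⌊X⌋₊, twist χ δ m * (Real.log (X / m) : ℂ)‖ ≤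
      (5 + 4 * K * π + 4 * Real.exp (9 / 2) * (1 + K * π) + C82 K) * Real.log D ^ 2 := by
  obtain ⟨hD2, hL200, hDexp, hsqrt, hKπL⟩ := basics_of_large (D := D) hK0 hL
  have hπ := Real.pi_pos
  set L : ℝ := Real.log D with hLdef
  have hL1 : 1 ≤ L := by linarith
  have hL3 : 3 ≤ L := by linarith
  have hKπ : 0 ≤ K * π := by positivity
  have hC82 := C82_nonneg hK0
  have hE : 0 ≤ 4 * Real.exp (9 / 2) * (1 + K * π) := by positivity
  by_cases hXT : X ≤ Real.exp (L ^ (11 / 10 : ℝ))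
  · refine (norm_riesz_short_le_pow15 χ hprim hK0 hL h15 hδre hδ hX0 hXT).trans ?_
    have : 0 ≤ (4 * Real.exp (9 / 2) * (1 + K * π) + C82 K) * L ^ 2 := by positivity
    nlinarith
  · have hTX : Real.exp (L ^ (11 / 10 : ℝ)) ≤ X := (not_le.mp hXT).le
    have hK4 : 4 * K * π ≤ L ^ 8 := by
      calc 4 * K * π = 4 * (K * π) := by ring
        _ ≤ 4 * L := by linarith
        _ ≤ L ^ 7 * L := by
            refine mul_le_mul_of_nonneg_right ?_ (by linarith)
            calc (4 : ℝ) ≤ 3 ^ 7 := by norm_num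
              _ ≤ L ^ 7 := pow_le_pow_left₀ (by norm_num) hL3 7
        _ = L ^ 8 := by ring
    have hmain := Repair.Gap.sum_twist_log_sub_main_le_pow15 χ hprim hL3 h15 hK0 hK4 hδre hδ hTX hXP
    have hX1 : 1 ≤ X := le_trans (Real.one_le_exp (by positivity)) hTX
    have hlogX0 : 0 ≤ Real.log X := Real.log_nonneg hX1
    have hlogX : Real.log X ≤ L ^ 9 := (Real.log_le_iff_le_exp hX0).mpr hXP
    have hL' : ‖deriv χ.LFunction 1‖ ≤ 2 * Real.exp (9 / 2) * (1 + L) * L :=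
      Lemma31.norm_deriv_LFunction_le_near_one χ hL3 hprim (w := 1) (by
        rw [sub_self, norm_zero]
        exact div_nonneg zero_le_one (by rw [← hLdef]; linarith))
    have hfac : ‖(1 : ℂ) + δ * (Real.log X : ℂ)‖ ≤ 1 + K * π := by
      calc ‖(1 : ℂ) + δ * (Real.log X : ℂ)‖ ≤ ‖(1 : ℂ)‖ + ‖δ * (Real.log X : ℂ)‖ := norm_add_le _ _
        _ = 1 + ‖δ‖ * Real.log X := by
            rw [norm_one, norm_mul, Complex.norm_real, Real.norm_of_nonneg hlogX0]
        _ ≤ 1 + K * π / L ^ 9 * L ^ 9 := by gcongr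
        _ = 1 + K * π := by field_simp
    have hmt : ‖deriv χ.LFunction 1 * (1 + δ * (Real.log X : ℂ))‖ ≤
        4 * Real.exp (9 / 2) * (1 + K * π) * L ^ 2 := by
      rw [norm_mul]
      calc ‖deriv χ.LFunction 1‖ * ‖(1 : ℂ) + δ * (Real.log X : ℂ)‖
          ≤ (2 * Real.exp (9 / 2) * (1 + L) * L) * (1 + K * π) :=
            mul_le_mul hL' hfac (norm_nonneg _) (by positivity)
        _ ≤ (2 * Real.exp (9 / 2) * (2 * L) * L) * (1 + K * π) := by gcongr; linarith
        _ = 4 * Real.exp (9 / 2) * (1 + K * π) * L ^ 2 := by ring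
    have herr : C82 K / L ^ 6 ≤ C82 K * L ^ 2 := by
      rw [div_le_iff₀ (by positivity)]
      calc C82 K = C82 K * 1 := (mul_one _).symm
        _ ≤ C82 K * (L ^ 2 * L ^ 6) :=
            mul_le_mul_of_nonneg_left (one_le_mul_of_one_le_of_one_le (one_le_pow₀ hL1)
              (one_le_pow₀ hL1)) hC82
        _ = C82 K * L ^ 2 * L ^ 6 := by ring
    calc ‖∑ m ∈ Finset.Ioc 0 ⌊X⌋₊, twist χ δ m * (Real.log (X / m) : ℂ)‖
        = ‖deriv χ.LFunction 1 * (1 + δ * (Real.log X : ℂ)) +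
            ((∑ m ∈ Finset.Ioc 0 ⌊X⌋₊, twist χ δ m * (Real.log (X / m) : ℂ)) -
              deriv χ.LFunction 1 * (1 + δ * (Real.log X : ℂ)))‖ := by rw [add_sub_cancel]
      _ ≤ 4 * Real.exp (9 / 2) * (1 + K * π) * L ^ 2 + C82 K * L ^ 2 :=
          (norm_add_le _ _).trans (add_le_add hmt (hmain.trans herr))
      _ ≤ _ := by nlinarith

/-- **(10.3) under the minimum premise** (twin of `Lemma101.range_two`, same main term and error `1500·C82(3+5c′)𝓛⁻¹⁵`):
`P^{0.5} < y ≤ P^{0.502}/T`, `‖L(1,χ)‖ ≤ 𝓛⁻¹⁵` in place of (A); long pieces by the Lemma 8.2 core twin.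
[cite: Zhang2022LandauSiegel, §10 Lemma 10.1 (10.3)] -/
theorem range_two_pow15 [NeZero D] (hprim : χ.IsPrimitive) {c' : ℝ} (hc' : 0 ≤ c')
    (hL : 1024 + (3 + 5 * c') * π ≤ Real.log D) (h15 : ‖χ.LFunction 1‖ ≤ 1 / Real.log D ^ 15)
    {j : ℕ} (hj : j ∈ ({1, 2, 3} : Finset ℕ)) {y : ℝ} (h1 : bigP D ^ (0.5 : ℝ) < y)
    (h2 : y ≤ bigP D ^ (0.502 : ℝ) / bigT D) :
    ‖frakv1 c' χ j y - 500 * deriv χ.LFunction 1 / Real.log (bigP D) *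
        (-1 - betaJ c' D j * (Real.log (y / bigP D ^ (0.5 : ℝ)) : ℂ))‖ ≤
      1500 * C82 (3 + 5 * c') / Real.log D ^ 15 := by
  obtain ⟨hlogP, hT, hPa⟩ := params D
  obtain ⟨hL200, hL3, hP1, hδre, hδn, hK4, -⟩ := setting (D := D) hc' hL hj
  have hK0 : 0 ≤ 3 + 5 * c' := by positivity
  set L : ℝ := Real.log D with hLdef
  set β : ℂ := betaJ c' D j with hβdef
  have hL0 : 0 < L := by linarith
  have hP0 : 0 < bigP D := by linarith
  have hPa0 : ∀ a : ℝ, 0 < bigP D ^ a := fun a => Real.rpow_pos_of_pos hP0 a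
  have hT0 : 0 < bigT D := by rw [hT]; exact Real.exp_pos _
  have hy0 : 0 < y := lt_trans (hPa0 _) h1
  have hy1 : 1 ≤ y := by
    refine le_trans ?_ h1.le
    rw [hPa]; exact Real.one_le_exp (by positivity)
  -- logarithms
  set ly : ℝ := Real.log y with hly
  have hly1 : 0.5 * L ^ 9 < ly := by
    have := Real.log_lt_log (hPa0 _) h1
    rwa [hPa, Real.log_exp] at this
  have hly2 : ly ≤ 0.502 * L ^ 9 - L ^ (11 / 10 : ℝ) := by
    have := Real.log_le_log hy0 h2
    rwa [Real.log_div (hPa0 _).ne' hT0.ne', hPa, Real.log_exp, hT, Real.log_exp] at this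
  have hX1log : Real.log (bigP D ^ (0.504 : ℝ) / y) = 0.504 * L ^ 9 - ly := by
    rw [Real.log_div (hPa0 _).ne' hy0.ne', hPa, Real.log_exp]
  have hX2log : Real.log (bigP D ^ (0.502 : ℝ) / y) = 0.502 * L ^ 9 - ly := by
    rw [Real.log_div (hPa0 _).ne' hy0.ne', hPa, Real.log_exp]
  have hylog : Real.log (y / bigP D ^ (0.5 : ℝ)) = ly - 0.5 * L ^ 9 := by
    rw [Real.log_div hy0.ne' (hPa0 _).ne', hPa, Real.log_exp]
  have hX10 : 0 < bigP D ^ (0.504 : ℝ) / y := by positivity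
  have hX20 : 0 < bigP D ^ (0.502 : ℝ) / y := by positivity
  -- the long pieces
  have hL90 : 0 < L ^ 9 := pow_pos hL0 9
  have hA1 := Repair.Gap.sum_twist_log_sub_main_le_pow15 χ hprim hL3 h15 hK0 hK4 hδre hδn
    (x := bigP D ^ (0.504 : ℝ) / y)
    ((Real.le_log_iff_exp_le hX10).mp (by rw [hX1log, ← hLdef]; linarith))
    ((Real.log_le_iff_le_exp hX10).mp (by rw [hX1log, ← hLdef]; linarith))
  have hA2 := Repair.Gap.sum_twist_log_sub_main_le_pow15 χ hprim hL3 h15 hK0 hK4 hδre hδn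
    (x := bigP D ^ (0.502 : ℝ) / y)
    ((Real.le_log_iff_exp_le hX20).mp (by rw [hX2log, ← hLdef]; linarith))
    ((Real.log_le_iff_le_exp hX20).mp (by rw [hX2log, ← hLdef]; linarith))
  -- the empty piece
  have hX3 : ⌊bigP D ^ (0.5 : ℝ) / y⌋₊ = 0 :=
    Nat.floor_eq_zero.mpr (by rw [div_lt_one hy0]; exact h1)
  rw [frakv1_eq χ c' j hy1 hP1, hX3, Finset.Ioc_self, Finset.sum_empty, add_zero]
  -- algebra of the main terms
  set A1 := ∑ m ∈ Finset.Ioc 0 ⌊bigP D ^ (0.504 : ℝ) / y⌋₊, twist χ (-β) m *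
    (Real.log (bigP D ^ (0.504 : ℝ) / y / m) : ℂ) with hA1def
  set A2 := ∑ m ∈ Finset.Ioc 0 ⌊bigP D ^ (0.502 : ℝ) / y⌋₊, twist χ (-β) m *
    (Real.log (bigP D ^ (0.502 : ℝ) / y / m) : ℂ) with hA2def
  set m1 : ℂ := deriv χ.LFunction 1 * (1 + -β * (Real.log (bigP D ^ (0.504 : ℝ) / y) : ℂ))
    with hm1
  set m2 : ℂ := deriv χ.LFunction 1 * (1 + -β * (Real.log (bigP D ^ (0.502 : ℝ) / y) : ℂ))
    with hm2
  have e : ((500 / Real.log (bigP D) : ℝ) : ℂ) * (A1 - 2 * A2) -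
      500 * deriv χ.LFunction 1 / Real.log (bigP D) *
        (-1 - β * (Real.log (y / bigP D ^ (0.5 : ℝ)) : ℂ)) =
      ((500 / Real.log (bigP D) : ℝ) : ℂ) * ((A1 - m1) - 2 * (A2 - m2)) := by
    rw [hm1, hm2, hX1log, hX2log, hylog, hlogP]
    push_cast
    ring
  rw [e, norm_mul, Complex.norm_real, Real.norm_of_nonneg (by rw [hlogP]; positivity), hlogP]
  calc 500 / L ^ 9 * ‖(A1 - m1) - 2 * (A2 - m2)‖
      ≤ 500 / L ^ 9 * (C82 (3 + 5 * c') / L ^ 6 + 2 * (C82 (3 + 5 * c') / L ^ 6)) := by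
        refine mul_le_mul_of_nonneg_left ?_ (by positivity)
        refine (norm_sub_le _ _).trans (add_le_add hA1 ?_)
        rw [norm_mul, Complex.norm_two]
        exact mul_le_mul_of_nonneg_left hA2 zero_le_two
    _ = 1500 * C82 (3 + 5 * c') / L ^ 15 := by
        rw [show C82 (3 + 5 * c') / L ^ 6 + 2 * (C82 (3 + 5 * c') / L ^ 6) =
          3 * C82 (3 + 5 * c') / L ^ 6 by ring, div_mul_div_comm, ← pow_add]
        ring

/-- **(10.4) under the minimum premise** (twin of `Lemma101.range_three`): `P^{0.502} < y ≤ P^{0.504}/T`,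
`‖L(1,χ)‖ ≤ 𝓛⁻¹⁵` in place of (A). [cite: Zhang2022LandauSiegel, §10 Lemma 10.1 (10.4)] -/
theorem range_three_pow15 [NeZero D] (hprim : χ.IsPrimitive) {c' : ℝ} (hc' : 0 ≤ c')
    (hL : 1024 + (3 + 5 * c') * π ≤ Real.log D) (h15 : ‖χ.LFunction 1‖ ≤ 1 / Real.log D ^ 15)
    {j : ℕ} (hj : j ∈ ({1, 2, 3} : Finset ℕ)) {y : ℝ} (h1 : bigP D ^ (0.502 : ℝ) < y)
    (h2 : y ≤ bigP D ^ (0.504 : ℝ) / bigT D) :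
    ‖frakv1 c' χ j y - 500 * deriv χ.LFunction 1 / Real.log (bigP D) *
        (1 - betaJ c' D j * (Real.log (bigP D ^ (0.504 : ℝ) / y) : ℂ))‖ ≤
      500 * C82 (3 + 5 * c') / Real.log D ^ 15 := by
  obtain ⟨hlogP, hT, hPa⟩ := params D
  obtain ⟨hL200, hL3, hP1, hδre, hδn, hK4, -⟩ := setting (D := D) hc' hL hj
  have hK0 : 0 ≤ 3 + 5 * c' := by positivity
  set L : ℝ := Real.log D with hLdef
  set β : ℂ := betaJ c' D j with hβdef
  have hL0 : 0 < L := by linarith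
  have hP0 : 0 < bigP D := by linarith
  have hPa0 : ∀ a : ℝ, 0 < bigP D ^ a := fun a => Real.rpow_pos_of_pos hP0 a
  have hT0 : 0 < bigT D := by rw [hT]; exact Real.exp_pos _
  have hy0 : 0 < y := lt_trans (hPa0 _) h1
  have hy1 : 1 ≤ y := by
    refine le_trans ?_ h1.le
    rw [hPa]; exact Real.one_le_exp (by positivity)
  set ly : ℝ := Real.log y with hly
  have hly1 : 0.502 * L ^ 9 < ly := by
    have := Real.log_lt_log (hPa0 _) h1
    rwa [hPa, Real.log_exp] at this
  have hly2 : ly ≤ 0.504 * L ^ 9 - L ^ (11 / 10 : ℝ) := by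
    have := Real.log_le_log hy0 h2
    rwa [Real.log_div (hPa0 _).ne' hT0.ne', hPa, Real.log_exp, hT, Real.log_exp] at this
  have hX1log : Real.log (bigP D ^ (0.504 : ℝ) / y) = 0.504 * L ^ 9 - ly := by
    rw [Real.log_div (hPa0 _).ne' hy0.ne', hPa, Real.log_exp]
  have hX10 : 0 < bigP D ^ (0.504 : ℝ) / y := by positivity
  have hL90 : 0 < L ^ 9 := pow_pos hL0 9
  have hA1 := Repair.Gap.sum_twist_log_sub_main_le_pow15 χ hprim hL3 h15 hK0 hK4 hδre hδn
    (x := bigP D ^ (0.504 : ℝ) / y)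
    ((Real.le_log_iff_exp_le hX10).mp (by rw [hX1log, ← hLdef]; linarith))
    ((Real.log_le_iff_le_exp hX10).mp (by rw [hX1log, ← hLdef]; linarith))
  -- the empty pieces
  have h05 : bigP D ^ (0.5 : ℝ) < y := by
    refine lt_trans ?_ h1
    rw [hPa, hPa]; exact Real.exp_lt_exp.mpr (by nlinarith [pow_pos hL0 9])
  have hX2 : ⌊bigP D ^ (0.502 : ℝ) / y⌋₊ = 0 :=
    Nat.floor_eq_zero.mpr (by rw [div_lt_one hy0]; exact h1)
  have hX3 : ⌊bigP D ^ (0.5 : ℝ) / y⌋₊ = 0 :=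
    Nat.floor_eq_zero.mpr (by rw [div_lt_one hy0]; exact h05)
  rw [frakv1_eq χ c' j hy1 hP1, hX2, hX3, Finset.Ioc_self, Finset.sum_empty, Finset.sum_empty,
    mul_zero, sub_zero, add_zero]
  set A1 := ∑ m ∈ Finset.Ioc 0 ⌊bigP D ^ (0.504 : ℝ) / y⌋₊, twist χ (-β) m *
    (Real.log (bigP D ^ (0.504 : ℝ) / y / m) : ℂ) with hA1def
  set m1 : ℂ := deriv χ.LFunction 1 * (1 + -β * (Real.log (bigP D ^ (0.504 : ℝ) / y) : ℂ))
    with hm1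
  have e : ((500 / Real.log (bigP D) : ℝ) : ℂ) * A1 -
      500 * deriv χ.LFunction 1 / Real.log (bigP D) *
        (1 - β * (Real.log (bigP D ^ (0.504 : ℝ) / y) : ℂ)) =
      ((500 / Real.log (bigP D) : ℝ) : ℂ) * (A1 - m1) := by
    rw [hm1]
    push_cast
    ring
  rw [e, norm_mul, Complex.norm_real, Real.norm_of_nonneg (by rw [hlogP]; positivity), hlogP]
  calc 500 / L ^ 9 * ‖A1 - m1‖ ≤ 500 / L ^ 9 * (C82 (3 + 5 * c') / L ^ 6) :=
        mul_le_mul_of_nonneg_left hA1 (by positivity)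
    _ = 500 * C82 (3 + 5 * c') / L ^ 15 := by
        rw [div_mul_div_comm, ← pow_add]

end Literature.NumberTheory.LFunctions.Zhang2022.Lemma101
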